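import Summits.Ventures.DiscreteObjects.Hadamard.ConferenceGraph333Normalizer83Index

/-!
# Normalisers of elements of order `41` and `37` in an automorphism group of srg(333,166,82,83): prime divisors (kernel)

Framing: lottery ticket; floor = certified bounds/negative ranges.  Cell pub-namedobj (venture DiscreteObjects),
target (H) = `H(668)`, hadamard gen 32.  Companion of `ConferenceGraph333Normalizer83` (`N(⟨ρ₈₃⟩)` is a `{2,83}`-group): the same Fermat
argument for any prime order,
* `normalizing_coprime_commutes_prime` — `ρ` of prime order `p`, `g ρ = ρ^m g`, `g^q = 1` with `q` coprime to `p − 1` ⇒ `g ρ = ρ g`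
  (the induced automorphism of `ℤ/p` has order dividing `gcd(q, p−1) = 1`);
and the element census (`41 ∣ orderOf σ ⇒ orderOf σ ∈ {41,82}`, `37 ∣ orderOf σ ⇒ orderOf σ ∈ {37,74,148}`, `ConferenceGraph333LargePrimeOrders`) give
* **`normalizer41_prime_dvd_card`** — a group of automorphisms normalising `⟨ρ⟩`, `ρ` a member of order `41`, is a `{2, 5, 41}`-group
  (an element of prime order `q ∉ {2, 5}` normalising `⟨ρ₄₁⟩` centralises it — `q` is coprime to `40` — and `41q` is not an element order);
* **`normalizer37_prime_dvd_card`** — for order `37`: a `{2, 3, 37}`-group (primes coprime to `36` centralise; `37q ∉ {37,74,148}`).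
(Whether `5 ∣ |N(⟨ρ₄₁⟩)|` or `3 ∣ |N(⟨ρ₃₇⟩)|` can occur — Frobenius groups `ℤ/41 ⋊ ℤ/5`, `ℤ/37 ⋊ ℤ/3` — is open: such an element of order `5`
resp. `3` would fix `13` resp. `9` vertices, one in each `ρ`-orbit; HANDOFF-H-g32 item 6.)
WORDS: structure of a HYPOTHETICAL object; ours (PROVISIONAL; standard group theory).  No `sorry`, no new definitions.
-/

namespace Summit.Ventures.DiscreteObjects.Hadamard

open Finset

section normalizers4137
variable {V : Type*} [Fintype V] [DecidableEq V]

omit [Fintype V] [DecidableEq V] in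
/-- **An element of order coprime to `p − 1` normalising an element `ρ` of prime order `p` centralises it.** -/
theorem normalizing_coprime_commutes_prime (g ρ : Equiv.Perm V) {p : ℕ} (hp : p.Prime) (hρo : orderOf ρ = p) {m q : ℕ}
    (h : g * ρ = ρ ^ m * g) (hgq : g ^ q = 1) (hq : Nat.Coprime q (p - 1)) : g * ρ = ρ * g := by
  haveI : Fact p.Prime := ⟨hp⟩
  have hk := normalizing_pow_pow g ρ h q
  rw [hgq, one_mul, mul_one] at hk
  have hmod : m ^ q ≡ 1 [MOD p] := by
    have e : ρ ^ (m ^ q) = ρ ^ 1 := by rw [pow_one]; exact hk.symm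
    rw [pow_eq_pow_iff_modEq, hρo] at e
    exact e
  have hm0 : (m : ZMod p) ≠ 0 := by
    intro h0
    rw [ZMod.natCast_eq_zero_iff] at h0
    obtain ⟨c, rfl⟩ := h0
    have : ρ ^ (p * c) = 1 := by rw [pow_mul, ← hρo, pow_orderOf_eq_one, one_pow]
    rw [this, one_mul] at h
    have hρ1 : ρ = 1 := mul_left_cancel (h.trans (mul_one g).symm)
    rw [hρ1, orderOf_one] at hρo
    exact hp.one_lt.ne' hρo.symm
  have h1 : (m : ZMod p) ^ q = 1 := by
    have := (ZMod.natCast_eq_natCast_iff _ _ _).mpr hmod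
    rwa [Nat.cast_pow, Nat.cast_one] at this
  have h2 : (m : ZMod p) ^ (p - 1) = 1 := ZMod.pow_card_sub_one_eq_one hm0
  have hm1 : (m : ZMod p) = 1 := (pow_eq_one_iff_of_coprime hq).mp ⟨h1, h2⟩
  have hmod1 : m ≡ 1 [MOD p] := by
    rw [← ZMod.natCast_eq_natCast_iff, Nat.cast_one]; exact hm1
  have e : ρ ^ m = ρ ^ 1 := by rw [pow_eq_pow_iff_modEq, hρo]; exact hmod1
  rw [h, e, pow_one]

/-- **`N(⟨ρ₄₁⟩)` is a `{2, 5, 41}`-group.** -/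
theorem normalizer41_prime_dvd_card (hV : Fintype.card V = 333) (A : Matrix V V ℤ)
    (h01 : ∀ x y, A x y = 0 ∨ A x y = 1) (hsymm : ∀ x y, A y x = A x y) (hdiag : ∀ x, A x x = 0)
    (hk : ∀ x, ∑ y, A x y = 166) (hsrg : ∀ x y, ∑ z, A x z * A z y = 83 * (1 + (if x = y then 1 else 0)) - A x y)
    (N : Subgroup (Equiv.Perm V)) (hN : ∀ g ∈ N, ∀ x y, A (g x) (g y) = A x y)
    (ρ : Equiv.Perm V) (hρ : ρ ^ 41 = 1) (hρ1 : ρ ≠ 1) (hρN : ρ ∈ N) (hnorm : ∀ g ∈ N, ∃ m : ℕ, g * ρ = ρ ^ m * g)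
    {q : ℕ} (hq : q.Prime) (hqd : q ∣ Nat.card N) : q = 2 ∨ q = 5 ∨ q = 41 := by
  classical
  haveI := Fact.mk hq
  haveI : Fact (Nat.Prime 41) := ⟨by norm_num⟩
  have hρo : orderOf ρ = 41 := orderOf_eq_prime hρ hρ1
  have hAρ := hN ρ hρN
  obtain ⟨g, hg⟩ := exists_prime_orderOf_dvd_card' q hqd
  have hg' : orderOf (g : Equiv.Perm V) = q := by rw [Subgroup.orderOf_coe, hg]
  have hgq : (g : Equiv.Perm V) ^ q = 1 := by rw [← hg']; exact pow_orderOf_eq_one _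
  obtain ⟨m, hm⟩ := hnorm g g.2
  by_cases h2 : q = 2
  · exact Or.inl h2
  by_cases h5 : q = 5
  · exact Or.inr (Or.inl h5)
  by_cases h41 : q = 41
  · exact Or.inr (Or.inr h41)
  exfalso
  have hcop40 : Nat.Coprime q (41 - 1) := by
    rw [show (41 - 1 : ℕ) = 2 ^ 3 * 5 by norm_num]
    exact Nat.Coprime.mul_right (Nat.Coprime.pow_right 3 ((Nat.coprime_primes hq Nat.prime_two).mpr h2))
      ((Nat.coprime_primes hq (by norm_num)).mpr h5)
  have hcomm := normalizing_coprime_commutes_prime (g : Equiv.Perm V) ρ (by norm_num) hρo hm hgq hcop40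
  have hcop : Nat.Coprime (orderOf (g : Equiv.Perm V)) (orderOf ρ) := by
    rw [hg', hρo]; exact (Nat.coprime_primes hq (by norm_num)).mpr h41
  have ho : orderOf ((g : Equiv.Perm V) * ρ) = q * 41 := by
    rw [(show Commute (g : Equiv.Perm V) ρ from hcomm).orderOf_mul_eq_mul_orderOf_of_coprime hcop, hg', hρo]
  have hA' : ∀ x y, A (((g : Equiv.Perm V) * ρ) x) (((g : Equiv.Perm V) * ρ) y) = A x y := by
    intro x y; rw [Equiv.Perm.mul_apply, Equiv.Perm.mul_apply, hN g g.2, hAρ]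
  have h41q := aut_orderOf_of_41_dvd hV A h01 hsymm hdiag hk hsrg _ hA' (by rw [ho]; exact Dvd.intro_left q rfl)
  rw [ho] at h41q
  rcases h41q with h | h
  · exact hq.one_lt.ne' (by omega)
  · exact h2 (by omega)

/-- **`N(⟨ρ₃₇⟩)` is a `{2, 3, 37}`-group.** -/
theorem normalizer37_prime_dvd_card (hV : Fintype.card V = 333) (A : Matrix V V ℤ)
    (h01 : ∀ x y, A x y = 0 ∨ A x y = 1) (hsymm : ∀ x y, A y x = A x y) (hdiag : ∀ x, A x x = 0)
    (hk : ∀ x, ∑ y, A x y = 166) (hsrg : ∀ x y, ∑ z, A x z * A z y = 83 * (1 + (if x = y then 1 else 0)) - A x y)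
    (N : Subgroup (Equiv.Perm V)) (hN : ∀ g ∈ N, ∀ x y, A (g x) (g y) = A x y)
    (ρ : Equiv.Perm V) (hρ : ρ ^ 37 = 1) (hρ1 : ρ ≠ 1) (hρN : ρ ∈ N) (hnorm : ∀ g ∈ N, ∃ m : ℕ, g * ρ = ρ ^ m * g)
    {q : ℕ} (hq : q.Prime) (hqd : q ∣ Nat.card N) : q = 2 ∨ q = 3 ∨ q = 37 := by
  classical
  haveI := Fact.mk hq
  haveI : Fact (Nat.Prime 37) := ⟨by norm_num⟩
  have hρo : orderOf ρ = 37 := orderOf_eq_prime hρ hρ1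
  have hAρ := hN ρ hρN
  obtain ⟨g, hg⟩ := exists_prime_orderOf_dvd_card' q hqd
  have hg' : orderOf (g : Equiv.Perm V) = q := by rw [Subgroup.orderOf_coe, hg]
  have hgq : (g : Equiv.Perm V) ^ q = 1 := by rw [← hg']; exact pow_orderOf_eq_one _
  obtain ⟨m, hm⟩ := hnorm g g.2
  by_cases h2 : q = 2
  · exact Or.inl h2
  by_cases h3 : q = 3
  · exact Or.inr (Or.inl h3)
  by_cases h37 : q = 37
  · exact Or.inr (Or.inr h37)
  exfalso
  have hcop36 : Nat.Coprime q (37 - 1) := by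
    rw [show (37 - 1 : ℕ) = 2 ^ 2 * 3 ^ 2 by norm_num]
    exact Nat.Coprime.mul_right (Nat.Coprime.pow_right 2 ((Nat.coprime_primes hq Nat.prime_two).mpr h2))
      (Nat.Coprime.pow_right 2 ((Nat.coprime_primes hq Nat.prime_three).mpr h3))
  have hcomm := normalizing_coprime_commutes_prime (g : Equiv.Perm V) ρ (by norm_num) hρo hm hgq hcop36
  have hcop : Nat.Coprime (orderOf (g : Equiv.Perm V)) (orderOf ρ) := by
    rw [hg', hρo]; exact (Nat.coprime_primes hq (by norm_num)).mpr h37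
  have ho : orderOf ((g : Equiv.Perm V) * ρ) = q * 37 := by
    rw [(show Commute (g : Equiv.Perm V) ρ from hcomm).orderOf_mul_eq_mul_orderOf_of_coprime hcop, hg', hρo]
  have hA' : ∀ x y, A (((g : Equiv.Perm V) * ρ) x) (((g : Equiv.Perm V) * ρ) y) = A x y := by
    intro x y; rw [Equiv.Perm.mul_apply, Equiv.Perm.mul_apply, hN g g.2, hAρ]
  have h37q := aut_orderOf_of_37_dvd hV A h01 hsymm hdiag hk hsrg _ hA' (by rw [ho]; exact Dvd.intro_left q rfl)
  rw [ho] at h37q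
  rcases h37q with h | h | h
  · exact hq.one_lt.ne' (by omega)
  · exact h2 (by omega)
  · have h4 : q = 4 := by omega
    rw [h4] at hq
    exact absurd hq (by norm_num)

end normalizers4137

end Summit.Ventures.DiscreteObjects.Hadamard
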